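import Summits.BirchSwinnertonDyer.BirchSwinnertonDyer.Theorems.Rank1ResidualJetPairingCounting
import Summits.BirchSwinnertonDyer.BirchSwinnertonDyer.Theorems.Rank1ResidualJetGlobalDualityLocal
import Literature.NumberTheory.GaloisRepresentations.LocalGlobalCohomologyFiniteProofs
import HarnessLib

/-!
# T1 JET (cell `bsd-jet`), road K, file 3/3: Poitou–Tate global duality for Selmer structures in
# COUNTING form — `[H¹_𝓖 : H¹_𝓕] · [H¹_{𝓕^*} : H¹_{𝓖^*}] = ∏_{v ∈ S} [𝓖_v : 𝓕_v]` — a kernel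
# theorem from the tree's element-form fact (Howard 2004 Thm. 2.1.11 / Jetchev 2008 Thm. 5.1)

HONEST FRAMING (programme file `BSD-LIT2PART-PROGRAMME-v1.md` §HONESTY, verbatim): «no tranche here
proves BSD; ARM L moves the LITERAL column of an r ≤ 1 census into the kernel-proved-modulo-named-print
column; ARM P changes what «named print» is worth.» THEOREMS ONLY (seat `bsd-jet-pv-1`, session g3;
`--supports stmt-BirchSwinnertonDyer-14418`, helper): no definition, no named fact, no `sorry`.
Nothing is booked; no flag is struck; 0 classes move. GENERIC: no elliptic curve, no reduction type,
no `p`-versus-`N` datum occurs anywhere in this file.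

## Why (road K: the kernel discharge of the reading binders K1 `JET.JetchevDivisibilityCarrierNe` and
## K3 `JET.JetchevDivisibilityCarrierMult`; line = sheet `HOME/sheets/PV2-J6-KERNEL.md`, stubs S1–S10)

D. Jetchev, Compos. Math. **144** (2008), §5 Thm. 5.1 (p. 822): «Let `𝓕 ≼ 𝓖` be two Selmer
structures on `E[p^m]`. Then there are exact sequences `0 → H¹_𝓕 → H¹_𝓖 → ⊕_v 𝓖_v/𝓕_v` and
`0 → H¹_{𝓖^*} → H¹_{𝓕^*} → ⊕_v 𝓕^*_v/𝓖^*_v` … Moreover, the images … are exact orthogonal complements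
with respect to the local pairings» (= Howard 2004 Thm. 2.1.11 = Mazur–Rubin 2004 Thm. 2.3.4 ⟸ Milne
I Thm. 4.10). The printed proof of Thm. 6.3 USES it as a product of cardinalities (p. 823: «This
allows us to apply global duality (Theorem 5.1) to conclude that Inv(𝓗_{𝓕₀(c)^*}^{ε}) = (m, m_max +
m′ − m) and Inv(𝓗_{𝓕₀(c)^*}^{−ε}) = (m_max)»; Lemma 5.2 (iii) `a + a^* = m`), and so does the cell's
abstract kernel form of Thm. 6.3, `JET.Section6.tamagawaExponent_le_mInfty_of_minimalCoreVertex`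
(`Theorems/Rank1ResidualJetSection6.lean`, p471669; hypotheses `horth_q : #im locq · #im locq' = #Q'`,
`horth_ℓ`). The tree's named fact `poitouTate_selmerStructure_duality K`
(`Literature/NumberTheory/GaloisCohomology/PoitouTateSelmerStructures.lean`) records the ELEMENT form
(conjuncts `IsPerfect`, `SumLocalTermEqZero`, `UnramifiedOrthogonal`, `SelmerComplement`; docstring:
«Not included: the counting form of "orthogonal complements"»). THIS FILE PROVES THE COUNTING FORM
from those conjuncts, for every number field `K`, level `n ≥ 1`, finite `n`-torsion module `M`, and
Selmer structures `𝓕 ≤ 𝓖` unramified outside a finite `S` that agree at the infinite places: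

  `[H¹_𝓖(K, M) : H¹_𝓕(K, M)] · [H¹_{𝓕^*}(K, M^D) : H¹_{𝓖^*}(K, M^D)] = ∏_{v ∈ T} [𝓖_v : 𝓕_v]`,

`T` = the finite places of `S` (`relIndex_selmerGroup_mul_relIndex_dualSelmerGroup`; `AddSubgroup.relIndex`,
so no global finiteness of `H¹(K, M)` is needed — all indices are finite because the local groups are).
For Jetchev's `𝓕₀ = 𝓕_⌈q⌉ ≼ 𝓕` (Def. 4.8; differ only at `v, v̄ ∣ q`) it reads
`[H_𝓕 : H_𝓕₀] · [H_{𝓕₀^*} : H_{𝓕^*}] = [Kum_v : Kum⁰_v] · [Kum_v̄ : Kum⁰_v̄]`, the total (both signs) form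
of `horth_q`; for `𝓕₀(c) ≼ (𝓕₀)^ℓ(c)` it is the total form of `horth_ℓ` ∕ Lemma 5.2 (iii).

## Proof (Milne I §0 bookkeeping over the element form; file 1/3 `Rank1ResidualJetPairingCounting` has the
## finite-group lemmas, file 2/3 `Rank1ResidualJetGlobalDualityLocal` the element form over `T`)

On `X = Π_{v∈T} H¹(K_v, M)`, `Y = Π_{v∈T} H¹(K_v, M^D)` (finite: `finite_galoisCohomology_one_toLocal`)
the sum of the local Tate pairings `bS = ∑_v ⟨·,·⟩_v` is perfect (`IsPerfect` termwise,
`sum_pairing_injective`). Put `F = Π 𝓕_v ≤ G = Π 𝓖_v ≤ X`, `L = loc_T(H¹_𝓖)`, `L' = loc_T(H¹_{𝓕^*})`.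
Then `G^⊥ = Π 𝓖_v^*`, `F^⊥ = Π 𝓕_v^*` (`iInf_ker_pi_eq`), and `(L + F)^⊥ = L' + G^⊥`: `⊇` by the
Poitou–Tate vanishing `∑_v ⟨x_v, y_v⟩_v = 0` (`SumLocalTermEqZero`, the terms off `T` vanishing one
by one — `sum_localTatePairingZMod_selmer_eq_zero`) and the definition of the dual conditions; `⊆` by
`SelmerComplement` (ii) (`exists_mem_dualSelmerGroup_of_forall_sum_eq_zero`). Since the structures
agree off `T`, the kernel of `H¹_𝓖 → G/F` is `H¹_𝓕` and that of `H¹_{𝓕^*} → F^⊥/G^⊥` is `H¹_{𝓖^*}`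
(`mem_selmerGroup_of_forall_mem`), so `[H¹_𝓖 : H¹_𝓕] = [L + F : F]` and
`[H¹_{𝓕^*} : H¹_{𝓖^*}] = [L' + G^⊥ : G^⊥]` (`AddSubgroup.relIndex_comap`); conclude by file 1/3's
`relIndex_mul_relIndex_eq_of_iInf_ker_sup`.

## What is NOT here (the remaining stubs of the (J∥) kernel line it serves)

The `±`-eigenspace refinement under `Gal(K/ℚ)` for a module coming from `ℚ` (stub S1: for `p` odd
the sum pairing splits as `H⁺ ⊥ H⁻` and the identity holds sign by sign — not proved here), the
instantiation to `M = E[p^m]` with Jetchev's structures `𝓕`, `𝓕_⌈q⌉`, `𝓖^a_b(c)` (stub S2) and the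
local index `[Kum_v : Kum⁰_v] = p^{min(m, ord_p c_q)}` (stub S3). References (locators only; no cited
FACT is declared): [cite: Jetchev2008, Thm. 5.1 (p. 822), Lemma 5.2 (iii), proof of Thm. 6.3 (p. 823)]
[cite: Howard2004HeegnerKolyvagin, Def. 2.1.6, Def. 2.1.10, Thm. 2.1.11 (arXiv:1202.6340 pp. 5–6)]
[cite: MilneADT2006, Ch. I §0 (0.19), Cor. 2.3, Thm. 4.10(b)] [cite: MazurRubin2004, Thm. 2.3.4].

Design: no definitions; the players `X`, `Y`, `bS`, `loc_T`, `F`, `G`, `L`, `L'` are local `set`s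
inside the proof; universe `u` for `K`, `M` as in `PoitouTate.lean`. Axioms: `propext`,
`Classical.choice`, `Quot.sound`.
-/

set_option autoImplicit false

noncomputable section

open scoped Classical
open Function NumberField IsDedekindDomain
open Literature.NumberTheory.GaloisRepresentations

universe u

namespace Summit.BirchSwinnertonDyer.Rank1Residual.JET.GlobalDuality

/-! ### The counting form -/

section Counting

open Literature.NumberTheory.GaloisCohomology
open Literature.NumberTheory.GaloisRepresentations.DiscreteGaloisModule (localTatePairingZMod
  tateDual SelmerStructure)

variable {K : Type u} [Field K] [NumberField K] {n : ℕ} {M : Type u} [AddCommGroup M]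
  [TopologicalSpace M] [DiscreteTopology M] [Finite M] {ρ : DiscreteGaloisModule K M}

/-- **Poitou–Tate global duality for Selmer structures, COUNTING FORM (Howard 2004 Thm. 2.1.11 ∕
Mazur–Rubin 2004 Thm. 2.3.4 ∕ Jetchev 2008 Thm. 5.1, «the images are exact orthogonal complements»,
read as a product of cardinalities).** Let `K` be a number field, `n ≥ 1`, `M` a finite discrete
`Γ_K`-module killed by `n` with Tate dual `M^D = Hom(M, μₙ)`, and `inv` a family of local invariant
maps having local Tate duality at the finite places (`IsPerfect`), the Poitou–Tate vanishing
(`SumLocalTermEqZero`) and Howard's complement property (`SelmerComplement`) — the tree's named fact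
`poitouTate_selmerStructure_duality K` supplies such a family. Let `S` be a finite set of places
containing the archimedean places, the places above `n` and the ramified places of `M`, `T` the set
of finite places of `S`, and `𝓕 ≤ 𝓖` Selmer structures on `M` unramified outside `S` which AGREE at
the infinite places. Then

`[H¹_𝓖(K, M) : H¹_𝓕(K, M)] · [H¹_{𝓕^*}(K, M^D) : H¹_{𝓖^*}(K, M^D)] = ∏_{v ∈ T} [𝓖_v : 𝓕_v]`

(`AddSubgroup.relIndex`; all indices are finite). PROOF: on `X = Π_{v∈T} H¹(K_v, M)`,
`Y = Π_{v∈T} H¹(K_v, M^D)` the sum of the local Tate pairings is perfect (`IsPerfect`); with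
`F = Π 𝓕_v ≤ G = Π 𝓖_v ≤ X`, `L = loc_T(H¹_𝓖)`, `L' = loc_T(H¹_{𝓕^*})` one has `G^⊥ = Π 𝓖_v^*`,
`F^⊥ = Π 𝓕_v^*` and `(L + F)^⊥ = L' + G^⊥` (`⊇`: the Poitou–Tate vanishing and the definition of the
dual conditions; `⊆`: `SelmerComplement`); the kernel of `H¹_𝓖 → G/F` is `H¹_𝓕` and that of
`H¹_{𝓕^*} → F^⊥/G^⊥` is `H¹_{𝓖^*}` (the structures agree off `T`); conclude by
`relIndex_mul_relIndex_eq_of_iInf_ker_sup`. This is the form in which Jetchev 2008 USES his Thm. 5.1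
(proof of Thm. 6.3, p. 823: «This allows us to apply global duality (Theorem 5.1) to conclude that
Inv(𝓗_{𝓕₀(c)^*}^{ε}) = (m, m_max + m′ − m) and Inv(𝓗_{𝓕₀(c)^*}^{−ε}) = (m_max)»; Lemma 5.2 (iii)
`a + a^* = m`), i.e. the hypotheses `horth_q`, `horth_ℓ` of the cell's abstract Thm. 6.3
(`JET.Section6.tamagawaExponent_le_mInfty_of_minimalCoreVertex`); the tree's fact records the element
form only («Not included: the counting form of "orthogonal complements"»,
`PoitouTateSelmerStructures.lean`). No hypothesis on any elliptic curve, reduction type or `p` vs `N`.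
[cite: Howard2004HeegnerKolyvagin, Thm. 2.1.11 (arXiv:1202.6340 p. 6)]
[cite: MilneADT2006, Ch. I, Thm. 4.10(b) and Cor. 2.3] [cite: Jetchev2008, Thm. 5.1 (p. 822) and proof of Thm. 6.3 (p. 823)] -/
theorem relIndex_selmerGroup_mul_relIndex_dualSelmerGroup [NeZero n] (inv : LocalInvariants K n)
    (hperf : inv.IsPerfect) (hvan : inv.SumLocalTermEqZero) (hSC : inv.SelmerComplement)
    (hM : ∀ m : M, n • m = 0)
    (S : Finset (Place K)) (T : Finset (HeightOneSpectrum (𝓞 K)))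
    (hT : ∀ v, (Sum.inr v : Place K) ∈ S ↔ v ∈ T)
    (hS : ∀ v : HeightOneSpectrum (𝓞 K), (Sum.inr v : Place K) ∉ S →
      ((n : ℕ) : 𝓞 K) ∉ v.asIdeal ∧ GaloisRep.IsUnramifiedAt v ρ)
    {𝓕 𝓖 : SelmerStructure ρ} (hle : 𝓕 ≤ 𝓖) (h𝓕 : 𝓕.IsUnramifiedOutside S)
    (h𝓖 : 𝓖.IsUnramifiedOutside S)
    (hinf : ∀ w : InfinitePlace K, 𝓕 (Sum.inl w) = 𝓖 (Sum.inl w)) :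
    𝓕.selmerGroup.relIndex 𝓖.selmerGroup *
        (inv.dualSelmerStructure ρ 𝓖).selmerGroup.relIndex
          (inv.dualSelmerStructure ρ 𝓕).selmerGroup =
      ∏ v ∈ T, (𝓕 (Sum.inr v)).relIndex (𝓖 (Sum.inr v)) := by
  classical
  -- finiteness of the local cohomology groups at the finite places of `T`
  haveI hfinX : ∀ t : T,
      Finite (galoisCohomology (ρ.toLocal (Sum.inr (t : HeightOneSpectrum (𝓞 K)))) 1) :=
    fun t => finite_galoisCohomology_one_toLocal ρ t
  haveI hfinY : ∀ t : T,
      Finite (galoisCohomology ((ρ.tateDual n).toLocal (Sum.inr (t : HeightOneSpectrum (𝓞 K)))) 1) :=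
    fun t => finite_galoisCohomology_one_tateDual_toLocal ρ n t
  -- the local Tate pairings at the places of `T` and their sum on `X × Y`
  set b : ∀ t : T, galoisCohomology (ρ.toLocal (Sum.inr (t : HeightOneSpectrum (𝓞 K)))) 1 →+
      galoisCohomology ((ρ.tateDual n).toLocal (Sum.inr (t : HeightOneSpectrum (𝓞 K)))) 1 →+
        ZMod n :=
    fun t => localTatePairingZMod ρ n (Sum.inr (t : HeightOneSpectrum (𝓞 K)))
      (inv (Sum.inr (t : HeightOneSpectrum (𝓞 K)))) with hb
  set bS : (∀ t : T, galoisCohomology (ρ.toLocal (Sum.inr (t : HeightOneSpectrum (𝓞 K)))) 1) →+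
      (∀ t : T, galoisCohomology ((ρ.tateDual n).toLocal (Sum.inr (t : HeightOneSpectrum (𝓞 K)))) 1)
        →+ ZMod n :=
    ∑ t : T, ((b t).comp (Pi.evalAddMonoidHom
        (fun t : T => galoisCohomology (ρ.toLocal (Sum.inr (t : HeightOneSpectrum (𝓞 K)))) 1) t)).compl₂
      (Pi.evalAddMonoidHom
        (fun t : T => galoisCohomology ((ρ.tateDual n).toLocal
          (Sum.inr (t : HeightOneSpectrum (𝓞 K)))) 1) t) with hbS_def
  have hbS : ∀ x y, bS x y = ∑ t, b t (x t) (y t) := fun x y => by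
    simp only [hbS_def, AddMonoidHom.finsetSum_apply, AddMonoidHom.compl₂_apply,
      AddMonoidHom.coe_comp, comp_apply, Pi.evalAddMonoidHom_apply]
  -- torsion and perfectness of the sum pairing
  have hXn : ∀ x : ∀ t : T, galoisCohomology (ρ.toLocal (Sum.inr (t : HeightOneSpectrum (𝓞 K)))) 1,
      n • x = 0 :=
    fun x => funext fun t => galoisCohomology.nsmul_eq_zero_of_forall _ hM (x t)
  have hYn : ∀ y : ∀ t : T,
      galoisCohomology ((ρ.tateDual n).toLocal (Sum.inr (t : HeightOneSpectrum (𝓞 K)))) 1,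
      n • y = 0 :=
    fun y => funext fun t => galoisCohomology.nsmul_eq_zero_of_forall _
      (fun f => DiscreteGaloisModule.TateDual.nsmul_eq_zero f) (y t)
  have hl : Injective bS :=
    sum_pairing_injective b bS hbS fun t => ((hperf t).2 ρ hM).1.injective
  have hr : Injective bS.flip :=
    sum_pairing_flip_injective b bS hbS fun t => ((hperf t).2 ρ hM).2.injective
  -- localisation to `T`, the products of local conditions, the images of the Selmer groups
  set locT := AddMonoidHom.pi fun t : T =>
    galoisCohomology.localization ρ (Sum.inr (t : HeightOneSpectrum (𝓞 K))) 1 with hlocT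
  set locT' := AddMonoidHom.pi fun t : T =>
    galoisCohomology.localization (ρ.tateDual n) (Sum.inr (t : HeightOneSpectrum (𝓞 K))) 1
    with hlocT'
  have hlocT_apply : ∀ x (t : T), locT x t =
      galoisCohomology.localization ρ (Sum.inr (t : HeightOneSpectrum (𝓞 K))) 1 x :=
    fun x t => by rw [hlocT, AddMonoidHom.pi_apply]
  have hlocT'_apply : ∀ y (t : T), locT' y t =
      galoisCohomology.localization (ρ.tateDual n) (Sum.inr (t : HeightOneSpectrum (𝓞 K))) 1 y :=
    fun y t => by rw [hlocT', AddMonoidHom.pi_apply]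
  set F := AddSubgroup.pi Set.univ fun t : T => 𝓕 (Sum.inr (t : HeightOneSpectrum (𝓞 K))) with hF
  set G := AddSubgroup.pi Set.univ fun t : T => 𝓖 (Sum.inr (t : HeightOneSpectrum (𝓞 K))) with hG
  set F' := AddSubgroup.pi Set.univ fun t : T =>
    inv.dualSelmerStructure ρ 𝓕 (Sum.inr (t : HeightOneSpectrum (𝓞 K))) with hF'
  set G' := AddSubgroup.pi Set.univ fun t : T =>
    inv.dualSelmerStructure ρ 𝓖 (Sum.inr (t : HeightOneSpectrum (𝓞 K))) with hG'
  set L := 𝓖.selmerGroup.map locT with hL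
  set L' := (inv.dualSelmerStructure ρ 𝓕).selmerGroup.map locT' with hL'
  have hFG : F ≤ G := fun x hx =>
    (AddSubgroup.mem_pi _).mpr fun t ht => hle _ ((AddSubgroup.mem_pi _).mp hx t ht)
  -- annihilators of the products of local conditions
  have hannG : (⨅ s ∈ G, (bS s).ker : AddSubgroup _) = G' := by
    rw [hG, iInf_ker_pi_eq b bS hbS, hG']
    congr 1
    funext t
    ext c
    rw [mem_iInf_ker_iff, LocalInvariants.dualSelmerStructure_apply,
      LocalInvariants.mem_dualLocalCondition_iff]
  have hannF : (⨅ s ∈ F, (bS s).ker : AddSubgroup _) = F' := by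
    rw [hF, iInf_ker_pi_eq b bS hbS, hF']
    congr 1
    funext t
    ext c
    rw [mem_iInf_ker_iff, LocalInvariants.dualSelmerStructure_apply,
      LocalInvariants.mem_dualLocalCondition_iff]
  -- the structures agree off `T`
  have hoff : ∀ v : Place K, (∀ t ∈ T, v ≠ Sum.inr t) → 𝓕 v = 𝓖 v := by
    intro v hv
    cases v with
    | inl w => exact hinf w
    | inr v =>
      have hvS : (Sum.inr v : Place K) ∉ S := fun h => hv v ((hT v).mp h) rfl
      exact SelmerStructure.IsUnramifiedOutside.apply_eq_of_not_mem h𝓕 h𝓖 hvS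
  -- the heart: `(L ⊔ F)^⊥ = L' ⊔ G^⊥`
  have hann : (⨅ s ∈ L ⊔ F, (bS s).ker : AddSubgroup _) = L' ⊔ ⨅ s ∈ G, (bS s).ker := by
    rw [hannG]
    apply le_antisymm
    · intro u hu
      rw [mem_iInf_ker_iff] at hu
      have huF : ∀ t : T,
          u t ∈ inv.dualSelmerStructure ρ 𝓕 (Sum.inr (t : HeightOneSpectrum (𝓞 K))) := by
        have hu' : u ∈ (⨅ s ∈ F, (bS s).ker : AddSubgroup _) :=
          (mem_iInf_ker_iff bS F u).mpr fun s hs => hu s (AddSubgroup.mem_sup_right hs)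
        rw [hannF] at hu'
        exact fun t => (AddSubgroup.mem_pi _).mp hu' t (Set.mem_univ _)
      have husum : ∀ x ∈ 𝓖.selmerGroup,
          ∑ t : T, b t (galoisCohomology.localization ρ
            (Sum.inr (t : HeightOneSpectrum (𝓞 K))) 1 x) (u t) = 0 := by
        intro x hx
        have h := hu (locT x) (AddSubgroup.mem_sup_left ⟨x, hx, rfl⟩)
        rw [hbS] at h
        simpa only [hlocT_apply] using h
      obtain ⟨y, hy, hyu⟩ := exists_mem_dualSelmerGroup_of_forall_sum_eq_zero hSC hM S T hT hS
        hle h𝓕 h𝓖 u huF husum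
      have hsplit : u = locT' y + (u - locT' y) := by abel
      rw [hsplit]
      refine AddSubgroup.add_mem_sup ⟨y, hy, rfl⟩ ?_
      refine (AddSubgroup.mem_pi _).mpr fun t _ => ?_
      have := neg_mem (hyu t)
      rw [neg_sub] at this
      simpa only [Pi.sub_apply, hlocT'_apply] using this
    · intro u hu
      obtain ⟨l', hl', g, hg, rfl⟩ := AddSubgroup.mem_sup.mp hu
      obtain ⟨y, hy, rfl⟩ := hl'
      rw [mem_iInf_ker_iff]
      intro s hs
      obtain ⟨l, hl, f, hf, rfl⟩ := AddSubgroup.mem_sup.mp hs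
      obtain ⟨x, hx, rfl⟩ := hl
      have hx' : ∀ v, galoisCohomology.localization ρ v 1 x ∈ 𝓖 v :=
        (SelmerStructure.mem_selmerGroup_iff _ _).mp hx
      have hy' : ∀ v, galoisCohomology.localization (ρ.tateDual n) v 1 y ∈
          inv.dualSelmerStructure ρ 𝓕 v :=
        (SelmerStructure.mem_selmerGroup_iff _ _).mp hy
      have hg' : ∀ t : T, g t ∈ inv.dualSelmerStructure ρ 𝓖 (Sum.inr (t : HeightOneSpectrum (𝓞 K))) :=
        fun t => (AddSubgroup.mem_pi _).mp hg t (Set.mem_univ _)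
      have hf' : ∀ t : T, f t ∈ 𝓕 (Sum.inr (t : HeightOneSpectrum (𝓞 K))) :=
        fun t => (AddSubgroup.mem_pi _).mp hf t (Set.mem_univ _)
      have h1 : bS (locT x) (locT' y) = 0 := by
        rw [hbS, ← sum_localTatePairingZMod_selmer_eq_zero hvan hM S T hT h𝓕 h𝓖 hinf hx hy,
          ← Finset.sum_coe_sort T]
        exact Finset.sum_congr rfl fun t _ => by rw [hlocT_apply, hlocT'_apply]
      have h2 : bS (locT x) g = 0 := by
        rw [hbS]
        exact Finset.sum_eq_zero fun t _ => by
          rw [hlocT_apply]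
          exact (LocalInvariants.mem_dualLocalCondition_iff _ _ _ _ _).mp (hg' t) _ (hx' _)
      have h3 : bS f (locT' y) = 0 := by
        rw [hbS]
        exact Finset.sum_eq_zero fun t _ => by
          rw [hlocT'_apply]
          exact (LocalInvariants.mem_dualLocalCondition_iff _ _ _ _ _).mp (hy' _) _ (hf' t)
      have h4 : bS f g = 0 := by
        rw [hbS]
        exact Finset.sum_eq_zero fun t _ =>
          (LocalInvariants.mem_dualLocalCondition_iff _ _ _ _ _).mp (hg' t) _ (hle _ (hf' t))
      rw [map_add, map_add, AddMonoidHom.add_apply, AddMonoidHom.add_apply, h1, h2, h3, h4,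
        add_zero, add_zero]
  -- the counting identity
  have hcount := relIndex_mul_relIndex_eq_of_iInf_ker_sup bS hXn hYn hl hr F G L L' hFG hann
  rw [hannG] at hcount
  -- `F.relIndex L = [H¹_𝓖 : H¹_𝓕]`
  have hkerF : F.comap locT ⊓ 𝓖.selmerGroup = 𝓕.selmerGroup := by
    apply le_antisymm
    · rintro x ⟨hxF, hxG⟩
      refine mem_selmerGroup_of_forall_mem 𝓕 𝓖 T (fun v hv => le_of_eq (hoff v hv).symm) hxG
        fun t ht => ?_
      have := (AddSubgroup.mem_pi _).mp (AddSubgroup.mem_comap.mp hxF) ⟨t, ht⟩ (Set.mem_univ _)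
      rwa [hlocT_apply] at this
    · intro x hx
      refine ⟨AddSubgroup.mem_comap.mpr ((AddSubgroup.mem_pi _).mpr fun t _ => ?_),
        selmerGroup_mono hle hx⟩
      rw [hlocT_apply]
      exact (SelmerStructure.mem_selmerGroup_iff _ _).mp hx _
  have ha : 𝓕.selmerGroup.relIndex 𝓖.selmerGroup = F.relIndex L := by
    rw [← hkerF, AddSubgroup.inf_relIndex_right, AddSubgroup.relIndex_comap]
  -- `G'.relIndex L' = [H¹_{𝓕^*} : H¹_{𝓖^*}]`
  have hkerG : G'.comap locT' ⊓ (inv.dualSelmerStructure ρ 𝓕).selmerGroup =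
      (inv.dualSelmerStructure ρ 𝓖).selmerGroup := by
    apply le_antisymm
    · rintro y ⟨hyG, hyF⟩
      refine mem_selmerGroup_of_forall_mem (inv.dualSelmerStructure ρ 𝓖)
        (inv.dualSelmerStructure ρ 𝓕) T (fun v hv => ?_) hyF fun t ht => ?_
      · rw [LocalInvariants.dualSelmerStructure_apply, LocalInvariants.dualSelmerStructure_apply]
        exact inv.dualLocalCondition_anti ρ v (le_of_eq (hoff v hv).symm)
      · have := (AddSubgroup.mem_pi _).mp (AddSubgroup.mem_comap.mp hyG) ⟨t, ht⟩ (Set.mem_univ _)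
        rwa [hlocT'_apply] at this
    · intro y hy
      refine ⟨AddSubgroup.mem_comap.mpr ((AddSubgroup.mem_pi _).mpr fun t _ => ?_),
        inv.selmerGroup_dualSelmerStructure_anti ρ hle hy⟩
      rw [hlocT'_apply]
      exact (SelmerStructure.mem_selmerGroup_iff _ _).mp hy _
  have hb' : (inv.dualSelmerStructure ρ 𝓖).selmerGroup.relIndex
      (inv.dualSelmerStructure ρ 𝓕).selmerGroup = G'.relIndex L' := by
    rw [← hkerG, AddSubgroup.inf_relIndex_right, AddSubgroup.relIndex_comap]
  -- `F.relIndex G = ∏_{v ∈ T} [𝓖_v : 𝓕_v]`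
  have hc : F.relIndex G = ∏ v ∈ T, (𝓕 (Sum.inr v)).relIndex (𝓖 (Sum.inr v)) := by
    have hcF : Nat.card F = ∏ t : T, Nat.card (𝓕 (Sum.inr (t : HeightOneSpectrum (𝓞 K)))) :=
      natCard_pi _
    have hcG : Nat.card G = ∏ t : T, Nat.card (𝓖 (Sum.inr (t : HeightOneSpectrum (𝓞 K)))) :=
      natCard_pi _
    have hFG' : Nat.card F * F.relIndex G = Nat.card G := by
      have := AddSubgroup.relIndex_mul_relIndex ⊥ F G bot_le hFG
      rwa [AddSubgroup.relIndex_bot_left, AddSubgroup.relIndex_bot_left] at this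
    have hloc : ∀ t : T, Nat.card (𝓕 (Sum.inr (t : HeightOneSpectrum (𝓞 K)))) *
        (𝓕 (Sum.inr (t : HeightOneSpectrum (𝓞 K)))).relIndex
          (𝓖 (Sum.inr (t : HeightOneSpectrum (𝓞 K)))) =
        Nat.card (𝓖 (Sum.inr (t : HeightOneSpectrum (𝓞 K)))) := fun t => by
      have := AddSubgroup.relIndex_mul_relIndex ⊥ (𝓕 (Sum.inr (t : HeightOneSpectrum (𝓞 K))))
        (𝓖 (Sum.inr (t : HeightOneSpectrum (𝓞 K)))) bot_le (hle _)
      rwa [AddSubgroup.relIndex_bot_left, AddSubgroup.relIndex_bot_left] at this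
    have key : Nat.card F * F.relIndex G =
        Nat.card F * ∏ v ∈ T, (𝓕 (Sum.inr v)).relIndex (𝓖 (Sum.inr v)) := by
      rw [hFG', hcG, hcF, ← Finset.prod_coe_sort T, ← Finset.prod_mul_distrib]
      exact Finset.prod_congr rfl fun t _ => (hloc t).symm
    exact Nat.eq_of_mul_eq_mul_left Nat.card_pos key
  rw [ha, hb', ← hc]
  exact hcount

end Counting



end Summit.BirchSwinnertonDyer.Rank1Residual.JET.GlobalDuality

end
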